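import Summits.HubbardSuperconductivity.HubbardSuperconductivity.Theorems.DeformationLadderLowEnergyRigidityTelescopeRigidityConverseBond
import Summits.HubbardSuperconductivity.HubbardSuperconductivity.Theorems.DeformationLadderLowEnergyRigidityTelescopeRigidityTopScale

/-!
# Telescope rigidity, part 9b: infrared pair-momentum rigidity gives top-scale cell rigidity

Route `DeformationLadder`, crux `LowEnergyRigidity` (item stmt-HubbardSuperconductivity-1892), line
`Sketch` (poincare-telescope). Support file (`--supports stmt-HubbardSuperconductivity-1892`).

The CONVERSE of part 6: at a point `(U, δ)`, the body of `TwistGap.TgPairMomentumRigidity` (pair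
weight at nonzero infrared momenta costs total energy) implies top-scale cell rigidity (for every
fixed cell count `k ≥ 4` and `ε > 0` some `J(k, ε) > 0` with
`J((k/L)⁴ Re⟨𝒟_k⟩ − ε) ≤ Re⟨H_L⟩ − E₀` eventually) — `topScaleRigidity_of_pairMomentumRigidity`.
With part 6 this makes TwistGap's rigidity crux at a point EQUIVALENT to macroscopic cell rigidity in
the telescope's language (`topScaleRigidity_iff_pairMomentumRigidity`).

Kinematics (`rigc_dirichlet_density_le`, every unit vector `φ`, `K ≥ 1`, `L ≥ k`):
`(k/L)⁴ Re⟨φ, 𝒟_k φ⟩ ≤ 96 p₀² k⁴/L² + 384 k² (2K+1)² S'_K(φ) + 48 p₀² k⁵/K`,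
`S'_K(φ) = Σ_{0 ≠ q ∈ W_K} L⁻⁴ ‖Δ_d(q) φ‖²`, by summing the one-bond estimate of part 9a over the
`2k²` cell bonds; then `K`, `σ` and `L₀` are chosen against `ε`. CONDITIONAL in use (the hypothesis
is conjecture-grade); the kinematic inequality is unconditional. No definitions. [folklore]
-/

noncomputable section

namespace Summit.HubbardSuperconductivity.HubbardSuperconductivity.Theorems.LowEnergyRigidity.Telescope

set_option linter.dupNamespace false -- summit = problem name (single-conjunct summit), D-0017

open Matrix Literature.MathematicalPhysics.QuantumLattice Literature.Probability.LatticeModels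
open scoped ComplexConjugate ComplexOrder Matrix.Norms.L2Operator
open Summit.HubbardSuperconductivity.HubbardSuperconductivity.Theses.DeformationLadder
open Summit.HubbardSuperconductivity.HubbardSuperconductivity.Theorems (minEnergyOn_le_re_rayleigh)

/-! ### The coarse Dirichlet density against the window sum -/

/-- `Re⟨φ, 𝒟_k φ⟩ = Σ_b Σ_i ‖(Δ_b − Δ_{b+eᵢ}) φ‖₂²`. [folklore] -/
theorem rigc_re_expect_cellDirichlet (L : ℕ) [NeZero L] (k : ℕ) [NeZero k] (φ : Fock (Orb (FermionTorus 2 L))) :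
    (expect (cellDirichlet L k) φ).re =
      ∑ b : TorusSite 2 k, ∑ i : Fin 2, eucNorm ((cellPair L k b - cellPair L k (b + Pi.single i 1)) *ᵥ φ) ^ 2 := by
  unfold cellDirichlet
  rw [re_expect_sum]
  refine Finset.sum_congr rfl fun b _ => ?_
  rw [re_expect_sum]
  refine Finset.sum_congr rfl fun i _ => ?_
  rw [rig_re_expect_gram]

/-- **The coarse Dirichlet density is controlled by the nonzero window weight** (kinematics, every unit
vector, `K ≥ 1`, `k ≤ L`): with `p₀ = 2Σ_e|d(e)/√2|`, `w_q = Σ_y conj χ_q(y) P_y φ`,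
`(k/L)⁴ Re⟨φ, 𝒟_k φ⟩ ≤ 96 p₀² k⁴/L² + 384 k² (2K+1)² (Σ_{q ∈ W'_K} ‖w_q‖²/L⁴) + 48 p₀² k⁵/K`. [folklore] -/
theorem rigc_dirichlet_density_le (L : ℕ) [NeZero L] (k : ℕ) [NeZero k] (hkL : k ≤ L) {K : ℕ} (hK : 1 ≤ K)
    {φ : Fock (Orb (FermionTorus 2 L))} (hφ : star φ ⬝ᵥ φ = 1) :
    ((k : ℝ) / (L : ℝ)) ^ 4 * (expect (cellDirichlet L k) φ).re ≤
      96 * (2 * ∑ e ∈ insert (0 : Site 2) unitSteps, |dWaveFormFactor e / Real.sqrt 2|) ^ 2 * (k : ℝ) ^ 4 / (L : ℝ) ^ 2 +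
        384 * (k : ℝ) ^ 2 * (((2 * K + 1) ^ 2 : ℕ) : ℝ) *
          ((∑ q ∈ Finset.univ.filter (fun q : TorusSite 2 L => q ≠ 0 ∧ ∀ j : Fin 2, min (q j).val (L - (q j).val) ≤ K),
            eucNorm (∑ y : TorusSite 2 L, conj (torusChar q y) • (localPair dWaveFormFactor L y *ᵥ φ)) ^ 2) / (L : ℝ) ^ 4) +
        48 * (2 * ∑ e ∈ insert (0 : Site 2) unitSteps, |dWaveFormFactor e / Real.sqrt 2|) ^ 2 * (k : ℝ) ^ 5 / K := by
  have hk : 0 < k := Nat.pos_of_ne_zero (NeZero.ne k)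
  have hL : (0 : ℝ) < L := Nat.cast_pos.mpr (Nat.pos_of_ne_zero (NeZero.ne L))
  have hkr : (0 : ℝ) < k := by exact_mod_cast hk
  have hKr : (0 : ℝ) < K := by exact_mod_cast hK
  have hkLr : (k : ℝ) ≤ L := by exact_mod_cast hkL
  set p₀ : ℝ := 2 * ∑ e ∈ insert (0 : Site 2) unitSteps, |dWaveFormFactor e / Real.sqrt 2| with hp₀
  set ℓ : ℝ := (L : ℝ) / k + 1 with hℓ
  set M : ℝ := (((2 * K + 1) ^ 2 : ℕ) : ℝ) with hM
  set S : ℝ := (∑ q ∈ Finset.univ.filter (fun q : TorusSite 2 L => q ≠ 0 ∧ ∀ j : Fin 2, min (q j).val (L - (q j).val) ≤ K),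
      eucNorm (∑ y : TorusSite 2 L, conj (torusChar q y) • (localPair dWaveFormFactor L y *ᵥ φ)) ^ 2) / (L : ℝ) ^ 4 with hS
  have hS0 : 0 ≤ S := by rw [hS]; exact div_nonneg (Finset.sum_nonneg fun _ _ => by positivity) (by positivity)
  have hM0 : 0 ≤ M := by rw [hM]; positivity
  -- sum of the one-bond bounds
  set B : ℝ := 12 * (ℓ ^ 2 * p₀ ^ 2 + ℓ ^ 4 * M * S + (L : ℝ) ^ 3 * ℓ * p₀ ^ 2 / K) with hB
  have hbond : ∀ (b : TorusSite 2 k) (i : Fin 2),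
      eucNorm ((cellPair L k b - cellPair L k (b + Pi.single i 1)) *ᵥ φ) ^ 2 ≤ B := fun b i =>
    rigc_bond_sq_le L k hK b i hφ
  have hD : (expect (cellDirichlet L k) φ).re ≤ (k : ℝ) ^ 2 * (2 * B) := by
    rw [rigc_re_expect_cellDirichlet]
    calc ∑ b : TorusSite 2 k, ∑ i : Fin 2, eucNorm ((cellPair L k b - cellPair L k (b + Pi.single i 1)) *ᵥ φ) ^ 2
        ≤ ∑ _b : TorusSite 2 k, ∑ _i : Fin 2, B := Finset.sum_le_sum fun b _ => Finset.sum_le_sum fun i _ => hbond b i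
      _ = (k : ℝ) ^ 2 * (2 * B) := by
          simp only [Finset.sum_const, Finset.card_univ, Fintype.card_fin, BondMode.card_torusSite_two, nsmul_eq_mul]
          push_cast
          ring
  -- `ℓ ≤ 2L/k`
  have hℓ1 : ℓ ≤ 2 * (L : ℝ) / k := by
    rw [hℓ]
    have : (1 : ℝ) ≤ (L : ℝ) / k := by rw [le_div_iff₀ hkr, one_mul]; exact hkLr
    have h2 : 2 * (L : ℝ) / k = 2 * ((L : ℝ) / k) := by ring
    linarith
  have hℓ0 : 0 ≤ ℓ := by positivity
  have hℓ2 : ℓ ^ 2 ≤ (2 * (L : ℝ) / k) ^ 2 := pow_le_pow_left₀ hℓ0 hℓ1 2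
  have hℓ4 : ℓ ^ 4 ≤ (2 * (L : ℝ) / k) ^ 4 := pow_le_pow_left₀ hℓ0 hℓ1 4
  -- the three terms
  have hc0 : 0 ≤ ((k : ℝ) / (L : ℝ)) ^ 4 * ((k : ℝ) ^ 2 * 2 * 12) := by positivity
  have h1 : ((k : ℝ) / (L : ℝ)) ^ 4 * ((k : ℝ) ^ 2 * 2 * 12) * (ℓ ^ 2 * p₀ ^ 2) ≤
      ((k : ℝ) / (L : ℝ)) ^ 4 * ((k : ℝ) ^ 2 * 2 * 12) * ((2 * (L : ℝ) / k) ^ 2 * p₀ ^ 2) :=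
    mul_le_mul_of_nonneg_left (mul_le_mul_of_nonneg_right hℓ2 (sq_nonneg _)) hc0
  have h2 : ((k : ℝ) / (L : ℝ)) ^ 4 * ((k : ℝ) ^ 2 * 2 * 12) * (ℓ ^ 4 * M * S) ≤
      ((k : ℝ) / (L : ℝ)) ^ 4 * ((k : ℝ) ^ 2 * 2 * 12) * ((2 * (L : ℝ) / k) ^ 4 * M * S) :=
    mul_le_mul_of_nonneg_left (mul_le_mul_of_nonneg_right (mul_le_mul_of_nonneg_right hℓ4 hM0) hS0) hc0
  have h3 : ((k : ℝ) / (L : ℝ)) ^ 4 * ((k : ℝ) ^ 2 * 2 * 12) * ((L : ℝ) ^ 3 * ℓ * p₀ ^ 2 / K) ≤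
      ((k : ℝ) / (L : ℝ)) ^ 4 * ((k : ℝ) ^ 2 * 2 * 12) * ((L : ℝ) ^ 3 * (2 * (L : ℝ) / k) * p₀ ^ 2 / K) := by
    refine mul_le_mul_of_nonneg_left ?_ hc0
    refine div_le_div_of_nonneg_right ?_ hKr.le
    exact mul_le_mul_of_nonneg_right (mul_le_mul_of_nonneg_left hℓ1 (by positivity)) (sq_nonneg _)
  have heq1 : ((k : ℝ) / (L : ℝ)) ^ 4 * ((k : ℝ) ^ 2 * 2 * 12) * ((2 * (L : ℝ) / k) ^ 2 * p₀ ^ 2) =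
      96 * p₀ ^ 2 * (k : ℝ) ^ 4 / (L : ℝ) ^ 2 := by field_simp; ring
  have heq2 : ((k : ℝ) / (L : ℝ)) ^ 4 * ((k : ℝ) ^ 2 * 2 * 12) * ((2 * (L : ℝ) / k) ^ 4 * M * S) =
      384 * (k : ℝ) ^ 2 * M * S := by field_simp; ring
  have heq3 : ((k : ℝ) / (L : ℝ)) ^ 4 * ((k : ℝ) ^ 2 * 2 * 12) * ((L : ℝ) ^ 3 * (2 * (L : ℝ) / k) * p₀ ^ 2 / K) =
      48 * p₀ ^ 2 * (k : ℝ) ^ 5 / K := by field_simp; ring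
  have hmain : ((k : ℝ) / (L : ℝ)) ^ 4 * ((k : ℝ) ^ 2 * (2 * B)) =
      ((k : ℝ) / (L : ℝ)) ^ 4 * ((k : ℝ) ^ 2 * 2 * 12) * (ℓ ^ 2 * p₀ ^ 2) +
      ((k : ℝ) / (L : ℝ)) ^ 4 * ((k : ℝ) ^ 2 * 2 * 12) * (ℓ ^ 4 * M * S) +
      ((k : ℝ) / (L : ℝ)) ^ 4 * ((k : ℝ) ^ 2 * 2 * 12) * ((L : ℝ) ^ 3 * ℓ * p₀ ^ 2 / K) := by
    rw [hB]; ring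
  calc ((k : ℝ) / (L : ℝ)) ^ 4 * (expect (cellDirichlet L k) φ).re
      ≤ ((k : ℝ) / (L : ℝ)) ^ 4 * ((k : ℝ) ^ 2 * (2 * B)) := mul_le_mul_of_nonneg_left hD (by positivity)
    _ ≤ 96 * p₀ ^ 2 * (k : ℝ) ^ 4 / (L : ℝ) ^ 2 + 384 * (k : ℝ) ^ 2 * M * S + 48 * p₀ ^ 2 * (k : ℝ) ^ 5 / K := by
        rw [hmain, ← heq1, ← heq2, ← heq3]; linarith

/-- The literal window term of `TwistGap.TgPairMomentumRigidity` in vector form: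
`Re⟨φ, Δ_d(q)ᴴΔ_d(q) φ⟩ = ‖Σ_y conj χ_q(y) P_y φ‖₂²`. [folklore] -/
theorem rigc_windowTerm_eq (L : ℕ) [NeZero L] (q : TorusSite 2 L) (φ : Fock (Orb (FermionTorus 2 L))) :
    (expect (Matrix.conjTranspose (∑ x : TorusSite 2 L, Complex.exp (-(2 * (Real.pi : ℂ) * Complex.I / (L : ℂ)) *
        ((∑ i : Fin 2, (q i).val * (x i).val : ℕ) : ℂ)) • localPair dWaveFormFactor L x) *
      (∑ x : TorusSite 2 L, Complex.exp (-(2 * (Real.pi : ℂ) * Complex.I / (L : ℂ)) *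
        ((∑ i : Fin 2, (q i).val * (x i).val : ℕ) : ℂ)) • localPair dWaveFormFactor L x)) φ).re =
      eucNorm (∑ y : TorusSite 2 L, conj (torusChar q y) • (localPair dWaveFormFactor L y *ᵥ φ)) ^ 2 := by
  rw [rig_re_expect_gram, rig_sum_smul_mulVec]
  congr 2
  refine Finset.sum_congr rfl fun y _ => ?_
  rw [rigc_phase_eq_conj_torusChar]

/-! ### The converse theorem -/

/-- **Infrared pair-momentum rigidity gives top-scale cell rigidity at the point** (converse of part 6,
`pairMomentumRigidity_of_topScaleRigidity`). At `(U, δ)`: if for every window `K` and slack `σ > 0`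
some rate `γ > 0` makes `γ (Σ_{0≠q∈W_K} L⁻⁴ Re⟨Δ_d(q)ᴴΔ_d(q)⟩_φ − σ) ≤ Re⟨H_L⟩_φ − E₀(L)` for all
even `L ≥ L₀` and unit sector `φ` (the body of `TwistGap.TgPairMomentumRigidity`), then for every fixed
cell count `k ≥ 4` and `ε > 0` some `J > 0` makes `J((k/L)⁴ Re⟨𝒟_k⟩_φ − ε) ≤ Re⟨H_L⟩_φ − E₀(L)`
eventually (kinematics `rigc_dirichlet_density_le`; `K`, `σ`, `L₀` chosen against `ε`).
CONDITIONAL (the hypothesis is conjecture-grade). [folklore] -/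
theorem topScaleRigidity_of_pairMomentumRigidity :
    ∀ (U δ : ℝ),
    (∀ (K : ℕ) (σ : ℝ), 0 < σ → ∃ γ : ℝ, 0 < γ ∧ ∃ L₀ : ℕ, ∀ (L : ℕ) [NeZero L], L₀ ≤ L → Even L →
      ∀ φ : Fock (Orb (FermionTorus 2 L)),
        φ ∈ (szSector (Λ := FermionTorus 2 L) (2 * ⌊(1 - δ) * (L : ℝ) ^ 2 / 2⌋₊) 0) → star φ ⬝ᵥ φ = 1 →
        γ * ((∑ k ∈ (Finset.univ.filter (fun k : TorusSite 2 L => k ≠ 0 ∧ ∀ i : Fin 2, min (k i).val (L - (k i).val) ≤ K)),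
            (expect (Matrix.conjTranspose (∑ x : TorusSite 2 L, Complex.exp (-(2 * (Real.pi : ℂ) * Complex.I / (L : ℂ)) *
                ((∑ i : Fin 2, (k i).val * (x i).val : ℕ) : ℂ)) • localPair dWaveFormFactor L x) *
              (∑ x : TorusSite 2 L, Complex.exp (-(2 * (Real.pi : ℂ) * Complex.I / (L : ℂ)) *
                ((∑ i : Fin 2, (k i).val * (x i).val : ℕ) : ℂ)) • localPair dWaveFormFactor L x)) φ).re / (L : ℝ) ^ 4) - σ) ≤
          (expect (hubbardTorus 2 L 1 U) φ).re -
            (hubbardTorus 2 L 1 U).minEnergyOn (szSector (Λ := FermionTorus 2 L) (2 * ⌊(1 - δ) * (L : ℝ) ^ 2 / 2⌋₊) 0)) →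
    (∀ (k : ℕ) [NeZero k], 4 ≤ k → ∀ ε : ℝ, 0 < ε → ∃ J : ℝ, 0 < J ∧ ∃ L₀ : ℕ, ∀ (L : ℕ) [NeZero L], L₀ ≤ L → Even L →
      ∀ φ : Fock (Orb (FermionTorus 2 L)),
        φ ∈ (szSector (Λ := FermionTorus 2 L) (2 * ⌊(1 - δ) * (L : ℝ) ^ 2 / 2⌋₊) 0) → star φ ⬝ᵥ φ = 1 →
        J * (((k : ℝ) / (L : ℝ)) ^ 4 * (expect (cellDirichlet L k) φ).re - ε) ≤
          (expect (hubbardTorus 2 L 1 U) φ).re -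
            (hubbardTorus 2 L 1 U).minEnergyOn (szSector (Λ := FermionTorus 2 L) (2 * ⌊(1 - δ) * (L : ℝ) ^ 2 / 2⌋₊) 0)) := by
  intro U δ hPMR k _ hk4 ε hε
  have hk : 0 < k := Nat.pos_of_ne_zero (NeZero.ne k)
  have hkr : (0 : ℝ) < k := by exact_mod_cast hk
  -- constants
  set p₀ : ℝ := 2 * ∑ e ∈ insert (0 : Site 2) unitSteps, |dWaveFormFactor e / Real.sqrt 2| with hp₀
  have hp₀0 : 0 ≤ p₀ := by rw [hp₀]; exact mul_nonneg zero_le_two (Finset.sum_nonneg fun _ _ => abs_nonneg _)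
  -- the window size: `48 p₀² k⁵ / K ≤ ε/3`
  set K : ℕ := ⌈144 * p₀ ^ 2 * (k : ℝ) ^ 5 / ε⌉₊ + 1 with hKdef
  have hK1 : 1 ≤ K := by omega
  have hKr : (0 : ℝ) < K := by exact_mod_cast hK1
  have hKε : 48 * p₀ ^ 2 * (k : ℝ) ^ 5 / K ≤ ε / 3 := by
    have h1 : 144 * p₀ ^ 2 * (k : ℝ) ^ 5 / ε ≤ (K : ℝ) := by
      have := Nat.le_ceil (144 * p₀ ^ 2 * (k : ℝ) ^ 5 / ε)
      have h3 : ((⌈144 * p₀ ^ 2 * (k : ℝ) ^ 5 / ε⌉₊ : ℕ) : ℝ) + 1 = (K : ℝ) := by rw [hKdef]; push_cast; ring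
      linarith
    rw [div_le_iff₀ hε] at h1
    rw [div_le_iff₀ hKr]
    linarith
  set M : ℝ := (((2 * K + 1) ^ 2 : ℕ) : ℝ) with hM
  have hM0 : 0 < M := by rw [hM]; positivity
  -- the slack and the rate from pair-momentum rigidity
  have hσ : 0 < ε / (3 * (384 * (k : ℝ) ^ 2 * M)) := by positivity
  obtain ⟨γ, hγ, L₁, hR⟩ := hPMR K (ε / (3 * (384 * (k : ℝ) ^ 2 * M))) hσ
  -- threshold: `96 p₀² k⁴ / L² ≤ ε/3` and `k ≤ L`
  set L₀ : ℕ := max L₁ (max k (⌈288 * p₀ ^ 2 * (k : ℝ) ^ 4 / ε⌉₊ + 1)) with hL₀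
  refine ⟨γ / (384 * (k : ℝ) ^ 2 * M), by positivity, L₀, ?_⟩
  intro L _ hL hev φ hφK hφ1
  have hL1 : L₁ ≤ L := le_trans (le_max_left _ _) hL
  have hkL : k ≤ L := le_trans (le_trans (le_max_left _ _) (le_max_right _ _)) hL
  have hLC : ⌈288 * p₀ ^ 2 * (k : ℝ) ^ 4 / ε⌉₊ + 1 ≤ L := le_trans (le_trans (le_max_right _ _) (le_max_right _ _)) hL
  have hLr : (0 : ℝ) < L := by
    have : 1 ≤ L := le_trans (by omega) hLC
    exact_mod_cast this
  have hLε : 96 * p₀ ^ 2 * (k : ℝ) ^ 4 / (L : ℝ) ^ 2 ≤ ε / 3 := by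
    have h1 : 288 * p₀ ^ 2 * (k : ℝ) ^ 4 / ε ≤ (L : ℝ) := by
      have := Nat.le_ceil (288 * p₀ ^ 2 * (k : ℝ) ^ 4 / ε)
      have h3 : ((⌈288 * p₀ ^ 2 * (k : ℝ) ^ 4 / ε⌉₊ : ℕ) : ℝ) + 1 ≤ (L : ℝ) := by exact_mod_cast hLC
      linarith
    rw [div_le_iff₀ hε] at h1
    have hL1' : (1 : ℝ) ≤ L := by exact_mod_cast (le_trans (by omega) hLC : 1 ≤ L)
    rw [div_le_iff₀ (by positivity : (0 : ℝ) < (L : ℝ) ^ 2)]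
    have h3 : 0 ≤ ε * (L : ℝ) * ((L : ℝ) - 1) := mul_nonneg (mul_nonneg hε.le hLr.le) (sub_nonneg.mpr hL1')
    nlinarith [h1, h3]
  -- abbreviations
  set H := hubbardTorus 2 L 1 U with hH
  set Sec := szSector (Λ := FermionTorus 2 L) (2 * ⌊(1 - δ) * (L : ℝ) ^ 2 / 2⌋₊) 0 with hSec
  set E : ℝ := (expect H φ).re - H.minEnergyOn Sec with hE
  have hE0 : 0 ≤ E := sub_nonneg.mpr (minEnergyOn_le_re_rayleigh _ _ hφK hφ1)
  set S : ℝ := (∑ q ∈ Finset.univ.filter (fun q : TorusSite 2 L => q ≠ 0 ∧ ∀ j : Fin 2, min (q j).val (L - (q j).val) ≤ K),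
      eucNorm (∑ y : TorusSite 2 L, conj (torusChar q y) • (localPair dWaveFormFactor L y *ᵥ φ)) ^ 2) / (L : ℝ) ^ 4 with hS
  -- pair-momentum rigidity at `(K, σ)`, in vector form
  have hR1 := hR L hL1 hev φ hφK hφ1
  have hwin : (∑ q ∈ Finset.univ.filter (fun q : TorusSite 2 L => q ≠ 0 ∧ ∀ j : Fin 2, min (q j).val (L - (q j).val) ≤ K),
      (expect (Matrix.conjTranspose (∑ x : TorusSite 2 L, Complex.exp (-(2 * (Real.pi : ℂ) * Complex.I / (L : ℂ)) *
          ((∑ i : Fin 2, (q i).val * (x i).val : ℕ) : ℂ)) • localPair dWaveFormFactor L x) *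
        (∑ x : TorusSite 2 L, Complex.exp (-(2 * (Real.pi : ℂ) * Complex.I / (L : ℂ)) *
          ((∑ i : Fin 2, (q i).val * (x i).val : ℕ) : ℂ)) • localPair dWaveFormFactor L x)) φ).re / (L : ℝ) ^ 4) = S := by
    rw [hS, Finset.sum_div]
    refine Finset.sum_congr rfl fun q _ => ?_
    rw [rigc_windowTerm_eq]
  rw [hwin] at hR1
  have hR2 : γ * (S - ε / (3 * (384 * (k : ℝ) ^ 2 * M))) ≤ E := hR1
  clear_value E
  -- kinematics
  have hkin := rigc_dirichlet_density_le L k hkL hK1 hφ1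
  rw [← hp₀, ← hM, ← hS] at hkin
  -- `384 k² M S ≤ 384 k² M (E/γ + σ) = E/J + ε/3`
  have hS1 : S ≤ E / γ + ε / (3 * (384 * (k : ℝ) ^ 2 * M)) := by
    have h1 : S - ε / (3 * (384 * (k : ℝ) ^ 2 * M)) ≤ E / γ := by
      rw [le_div_iff₀' hγ]; exact hR2
    linarith
  have hkM : 0 < 384 * (k : ℝ) ^ 2 * M := by positivity
  have h2 : 384 * (k : ℝ) ^ 2 * M * S ≤ 384 * (k : ℝ) ^ 2 * M * (E / γ) + ε / 3 := by
    have := mul_le_mul_of_nonneg_left hS1 hkM.le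
    have heq : 384 * (k : ℝ) ^ 2 * M * (ε / (3 * (384 * (k : ℝ) ^ 2 * M))) = ε / 3 := by field_simp
    linarith [heq]
  -- conclude: `D ≤ E/J + ε`
  have hD : ((k : ℝ) / (L : ℝ)) ^ 4 * (expect (cellDirichlet L k) φ).re - ε ≤ 384 * (k : ℝ) ^ 2 * M * (E / γ) := by
    linarith
  have hJ : 0 < γ / (384 * (k : ℝ) ^ 2 * M) := by positivity
  calc γ / (384 * (k : ℝ) ^ 2 * M) * (((k : ℝ) / (L : ℝ)) ^ 4 * (expect (cellDirichlet L k) φ).re - ε)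
      ≤ γ / (384 * (k : ℝ) ^ 2 * M) * (384 * (k : ℝ) ^ 2 * M * (E / γ)) := mul_le_mul_of_nonneg_left hD hJ.le
    _ = E := by field_simp

/-- **Equivalence at a point**: infrared pair-momentum rigidity (the body of
`TwistGap.TgPairMomentumRigidity` at `(U, δ)`) holds iff top-scale cell rigidity at `(U, δ)` holds
(parts 6 and 9). TwistGap's rigidity crux, pointwise, IS macroscopic cell rigidity in the telescope's
language. [folklore] -/
theorem topScaleRigidity_iff_pairMomentumRigidity (U δ : ℝ) :
    (∀ (k : ℕ) [NeZero k], 4 ≤ k → ∀ ε : ℝ, 0 < ε → ∃ J : ℝ, 0 < J ∧ ∃ L₀ : ℕ, ∀ (L : ℕ) [NeZero L], L₀ ≤ L → Even L →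
      ∀ φ : Fock (Orb (FermionTorus 2 L)),
        φ ∈ (szSector (Λ := FermionTorus 2 L) (2 * ⌊(1 - δ) * (L : ℝ) ^ 2 / 2⌋₊) 0) → star φ ⬝ᵥ φ = 1 →
        J * (((k : ℝ) / (L : ℝ)) ^ 4 * (expect (cellDirichlet L k) φ).re - ε) ≤
          (expect (hubbardTorus 2 L 1 U) φ).re -
            (hubbardTorus 2 L 1 U).minEnergyOn (szSector (Λ := FermionTorus 2 L) (2 * ⌊(1 - δ) * (L : ℝ) ^ 2 / 2⌋₊) 0)) ↔
    (∀ (K : ℕ) (σ : ℝ), 0 < σ → ∃ γ : ℝ, 0 < γ ∧ ∃ L₀ : ℕ, ∀ (L : ℕ) [NeZero L], L₀ ≤ L → Even L →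
      ∀ φ : Fock (Orb (FermionTorus 2 L)),
        φ ∈ (szSector (Λ := FermionTorus 2 L) (2 * ⌊(1 - δ) * (L : ℝ) ^ 2 / 2⌋₊) 0) → star φ ⬝ᵥ φ = 1 →
        γ * ((∑ k ∈ (Finset.univ.filter (fun k : TorusSite 2 L => k ≠ 0 ∧ ∀ i : Fin 2, min (k i).val (L - (k i).val) ≤ K)),
            (expect (Matrix.conjTranspose (∑ x : TorusSite 2 L, Complex.exp (-(2 * (Real.pi : ℂ) * Complex.I / (L : ℂ)) *
                ((∑ i : Fin 2, (k i).val * (x i).val : ℕ) : ℂ)) • localPair dWaveFormFactor L x) *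
              (∑ x : TorusSite 2 L, Complex.exp (-(2 * (Real.pi : ℂ) * Complex.I / (L : ℂ)) *
                ((∑ i : Fin 2, (k i).val * (x i).val : ℕ) : ℂ)) • localPair dWaveFormFactor L x)) φ).re / (L : ℝ) ^ 4) - σ) ≤
          (expect (hubbardTorus 2 L 1 U) φ).re -
            (hubbardTorus 2 L 1 U).minEnergyOn (szSector (Λ := FermionTorus 2 L) (2 * ⌊(1 - δ) * (L : ℝ) ^ 2 / 2⌋₊) 0)) :=
  ⟨pairMomentumRigidity_of_topScaleRigidity U δ, topScaleRigidity_of_pairMomentumRigidity U δ⟩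

end Summit.HubbardSuperconductivity.HubbardSuperconductivity.Theorems.LowEnergyRigidity.Telescope
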